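import Summits.QuantumFields.YangMills.Theorems.LuscherReductionOneSiteLevelsKacDefs
import Literature.Analysis.OperatorTheory.YangMillsMatrixModelRadialCutoff
import HarnessLib

/-!
# INNER, flat lane, helper III.0: Lebesgue measure on `ℝ⁹` is invariant under colour rotations; Gaussian smoothing preserves
# gauge (colour-rotation) invariance

Support module of crux `OneSiteLevels` (route `LuscherReduction`, item stmt-QuantumFields-20007; skeleton v12, FLAT lane stub
`stub_flatKacAL1`), helper **III.0** of STUB-PLAN `Cruxes/OneSiteLevels/STUB-PLAN-stub_absUpperInnerAL1.md` rev 2 §2.2 (the one rev-1 missed: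
«`IsGaugeInv (heatSmooth s g)` needs MEASURE invariance under `colourRotate R`, not just `norm_colourRotate`»; consumed by H6d ∕ G5 admissibility).
Fleet service by seat ym-infvol-p2 (cell ym-fleet).  Elementary change of variables, kernel-checked:

* `colourRotate_add`, `colourRotate_sub` (with the tree's `colourRotate_smul`: `colourRotate R` is linear);
* `exists_linearIsometryEquiv_eq_colourRotate` — for `R ∈ SO(3)` the map `colourRotate R` IS a linear isometry equivalence of `ZM = ℝ⁹`
  (`norm_colourRotate` + `LinearIsometry.toLinearIsometryEquiv`, equal dimensions);
* **`measurePreserving_colourRotate`** — `MeasurePreserving (colourRotate R) volume volume` (Mathlib `LinearIsometryEquiv.measurePreserving`);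
  `integral_comp_colourRotate` — `∫ f (colourRotate R x) dx = ∫ f`, no measurability hypothesis (measurable embedding);
* `heatKernel_colourRotate` — `p_t(Rx, Ry) = p_t(x, y)`; **`isGaugeInv_heatSmooth`** — `IsGaugeInv g → IsGaugeInv (heatSmooth t g)`.

HONEST FRAMING: femto rung R2b1 plumbing for the flat Kac-form lane; nothing here is a statement about the lattice theory, infinite volume or
the Clay gap.  References: P. van Baal, in *At the frontier of particle physics* (2001) §4 [cite: Vanbaal2001]; M. Reed, B. Simon IV (1978) XIII.
-/

set_option autoImplicit false

noncomputable section

open MeasureTheory Filter Topology Real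
open Literature.Analysis.OperatorTheory.YMMatrixModel

namespace Summit.QuantumFields.YangMills.Theorems.FemtoTransferGap

/-- Colour rotation is additive. [cite: Vanbaal2001, §4] -/
theorem colourRotate_add (M : Matrix (Fin 3) (Fin 3) ℝ) (x y : ZM) :
    colourRotate M (x + y) = colourRotate M x + colourRotate M y := by
  ext p
  simp [colourRotate, mul_add, Finset.sum_add_distrib]

/-- Colour rotation commutes with subtraction. [cite: Vanbaal2001, §4] -/
theorem colourRotate_sub (M : Matrix (Fin 3) (Fin 3) ℝ) (x y : ZM) :
    colourRotate M (x - y) = colourRotate M x - colourRotate M y := by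
  ext p
  simp [colourRotate, mul_sub, Finset.sum_sub_distrib]

/-- **For `R ∈ SO(3)` the colour rotation is a linear isometry equivalence of `ℝ⁹`** (linear: `colourRotate_add`, `colourRotate_smul`; isometric:
`norm_colourRotate`; onto by equality of dimensions). [cite: Vanbaal2001, §4] -/
theorem exists_linearIsometryEquiv_eq_colourRotate {R : Matrix (Fin 3) (Fin 3) ℝ}
    (hR : R ∈ Matrix.specialOrthogonalGroup (Fin 3) ℝ) :
    ∃ e : ZM ≃ₗᵢ[ℝ] ZM, (e : ZM → ZM) = colourRotate R := by
  let li : ZM →ₗᵢ[ℝ] ZM :=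
    { toFun := colourRotate R
      map_add' := colourRotate_add R
      map_smul' := fun c x => by simp [colourRotate_smul]
      norm_map' := norm_colourRotate hR }
  exact ⟨li.toLinearIsometryEquiv rfl, rfl⟩

/-- **Colour rotations preserve Lebesgue measure on `ℝ⁹`.** [cite: Vanbaal2001, §4] -/
theorem measurePreserving_colourRotate {R : Matrix (Fin 3) (Fin 3) ℝ} (hR : R ∈ Matrix.specialOrthogonalGroup (Fin 3) ℝ) :
    MeasurePreserving (colourRotate R) (volume : Measure ZM) volume := by
  obtain ⟨e, he⟩ := exists_linearIsometryEquiv_eq_colourRotate hR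
  rw [← he]
  exact e.measurePreserving

/-- **Change of variables**: `∫ f (colourRotate R x) dx = ∫ f` for every integrand (no measurability needed: `colourRotate R` is a measurable
embedding). [cite: Vanbaal2001, §4] -/
theorem integral_comp_colourRotate {E : Type*} [NormedAddCommGroup E] [NormedSpace ℝ E] {R : Matrix (Fin 3) (Fin 3) ℝ}
    (hR : R ∈ Matrix.specialOrthogonalGroup (Fin 3) ℝ) (f : ZM → E) :
    ∫ x, f (colourRotate R x) = ∫ x, f x := by
  obtain ⟨e, he⟩ := exists_linearIsometryEquiv_eq_colourRotate hR
  rw [← he]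
  exact e.measurePreserving.integral_comp e.toHomeomorph.measurableEmbedding f

/-- The heat kernel is colour-rotation invariant: `p_t(Rx, Ry) = p_t(x, y)`. [cite: ReedSimonIV1978, Thm. XIII.1–2] -/
theorem heatKernel_colourRotate {R : Matrix (Fin 3) (Fin 3) ℝ} (hR : R ∈ Matrix.specialOrthogonalGroup (Fin 3) ℝ) (t : ℝ)
    (x y : ZM) : heatKernel t (colourRotate R x) (colourRotate R y) = heatKernel t x y := by
  unfold heatKernel
  rw [← colourRotate_sub, norm_colourRotate hR]

/-- **Gaussian smoothing preserves gauge invariance**: `IsGaugeInv g → IsGaugeInv (heatSmooth t g)` (change of variables `y ↦ Ry` in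
`∫ p_t(Rx, y) g(y) dy`, invariance of the kernel and of `g`). [cite: Vanbaal2001, §4] -/
theorem isGaugeInv_heatSmooth (t : ℝ) {g : ZM → ℝ} (hg : IsGaugeInv g) : IsGaugeInv (heatSmooth t g) := by
  intro R hR x
  unfold heatSmooth
  rw [← integral_comp_colourRotate hR (fun y => heatKernel t (colourRotate R x) y * g y)]
  refine integral_congr_ae (ae_of_all _ fun y => ?_)
  simp only [heatKernel_colourRotate hR, hg R hR y]

/-- The smoothed function at a rotated point, as a smoothing of the rotated function: `(P_t g)(Rx) = P_t (g ∘ R)(x)`. [cite: Vanbaal2001, §4] -/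
theorem heatSmooth_colourRotate {R : Matrix (Fin 3) (Fin 3) ℝ} (hR : R ∈ Matrix.specialOrthogonalGroup (Fin 3) ℝ) (t : ℝ)
    (g : ZM → ℝ) (x : ZM) : heatSmooth t g (colourRotate R x) = heatSmooth t (fun y => g (colourRotate R y)) x := by
  unfold heatSmooth
  rw [← integral_comp_colourRotate hR (fun y => heatKernel t (colourRotate R x) y * g y)]
  refine integral_congr_ae (ae_of_all _ fun y => ?_)
  simp only [heatKernel_colourRotate hR]

end Summit.QuantumFields.YangMills.Theorems.FemtoTransferGap

end
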